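import Mathlib
import Summits.Ventures.HodgeRepro2.Tier7.Line3.KappaSwap

/-!
# Tier 7 — LINE 3 support: the global two-torus invariant at the archimedean places
(`Line3/KappaPlaces.lean`; t7-L1-p5, gen 2; continues `Line3/KappaNatural` / `KappaArchimedean` / `KappaSwap`)

Memo §2f, right-hand column, item (3): «hT — the definite place bounded: `|κ|_{ι₁} ≤ 1` needs κ of the REAL γ». For
the GLOBAL invariant `kappa σ d f γ ∈ E` of an isometry `γ` of the adapted form over the CM field `E` (involution `σ`)
this file proves, from the place's signature datum alone:
* `isIsom_of_std` / `isIsom_map`: the isometry condition is the four Gram identities on the standard basis, hence a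
  polynomial identity in the entries — it is carried along any ring homomorphism `ψ : E →+* E′` intertwining the
  involutions (`γ ∈ U(W_A)(F)` maps into `U(1,1)` / `U(2)` at each archimedean place).
* `sigma_kappa`: `σ (kappa σ d f γ) = kappa σ d f γ` — «κ(γ) ∈ F», the σ-fixed field, in the kernel.
* `map_kappa_sig20`: at a place `ψ : E →+* ℂ` whose image data form a `Sig20Data` (the definite place `ι₁`),
  `ψ (κ(γ)) = t` with `t ∈ [0, 1]`; `norm_map_kappa_le_one_sig20`: `‖ψ (κ(γ))‖ ≤ 1` — the bound `Binf = 1` at `ι₁` of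
  `ProductFormulaSeparation.inv_mul_pow_le_archSizeOn` for the REAL γ (x1's `KappaDefiniteBound` is its model form).
* `map_kappa_sig11`: at a `(1,1)`-place (`Sig11Data`), `ψ (κ(γ)) = t` with `1 ≤ t` (real); `map_kappa_sig11_swap`: with the
  negative line first, `t ≤ 0`.
* `infinitePlace_kappa_le_one` / `one_le_infinitePlace_kappa` / `infinitePlace_kappa_sub_le_one`: the same for `κ`
  read in a number field `K` through `algebraMap K E` (`κF : K` with `algebraMap K E κF = kappa σ d f γ`) at the
  infinite place `InfinitePlace.mk φ` compatible with `ψ`; the last one is the `hT` hypothesis of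
  `ProductFormulaSeparation.inv_mul_pow_le_archSizeOn` with `Binf w = 1` at a definite place, for the real γ's.

* `kappa_smul_mat` / `isIsom_smul` / `Sig11Data.exists_SU11'`: κ is invariant under `γ ↦ c • γ` with `N(c) = 1`, so the
  literal `SU(1,1)` form of `KappaArchimedean.Sig11Data.exists_SU11` holds for EVERY isometry (a phase makes `det = 1`).

What stays in words: that the §0 data at `ι₁ / ι₂ / ι₃` ARE `Sig20Data` / `Sig11Data` (the printed signature of `W_A`),
and that the global adapted pair is the one read at every place (t7-crit-2 l. 15198 record (2)). Nothing about the real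
group, periods, orbital integrals or (N). Pure algebra.
Sorry-free; axioms: propext / Classical.choice / Quot.sound. §8(d): uses an L-value-free non-vanishing device: NO.
-/

namespace Summit.Ventures.HodgeRepro2.Tier7.Line3.KappaPlaces

open Matrix Summit.Ventures.HodgeRepro2.T7SupportTwoTorusInvariant
  Summit.Ventures.HodgeRepro2.Tier7.Line3.KappaNatural Summit.Ventures.HodgeRepro2.Tier7.Line3.KappaArchimedean
  Summit.Ventures.HodgeRepro2.Tier7.Line3.KappaSwap

section general

variable {E : Type*} [Field E] (σ : E →+* E)

/-- `herm σ d` is additive in the first slot -/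
theorem herm_add_left (d : Fin 2 → E) (x x' y : Fin 2 → E) :
    herm σ d (x + x') y = herm σ d x y + herm σ d x' y := by
  unfold herm
  rw [← Finset.sum_add_distrib]
  refine Finset.sum_congr rfl fun i _ => ?_
  simp only [Pi.add_apply]
  ring

/-- `herm σ d` is additive in the second slot -/
theorem herm_add_right (d : Fin 2 → E) (x y y' : Fin 2 → E) :
    herm σ d x (y + y') = herm σ d x y + herm σ d x y' := by
  unfold herm
  rw [← Finset.sum_add_distrib]
  refine Finset.sum_congr rfl fun i _ => ?_
  simp only [Pi.add_apply, map_add]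
  ring

/-- every vector is `x₀ e₀ + x₁ e₁` -/
theorem eq_sum_std (x : Fin 2 → E) : x = x 0 • std 0 + x 1 • std 1 := by
  funext i
  fin_cases i <;> simp [std]

/-- **an isometry is determined on the standard basis**: the four Gram identities give `IsIsom` -/
theorem isIsom_of_std (d : Fin 2 → E) (g : Matrix (Fin 2) (Fin 2) E)
    (h : ∀ i j, herm σ d (g *ᵥ std i) (g *ᵥ std j) = herm σ d (std i) (std j)) : IsIsom σ d g := by
  intro x y
  have hx : g *ᵥ x = x 0 • (g *ᵥ std 0) + x 1 • (g *ᵥ std 1) := by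
    conv_lhs => rw [eq_sum_std x]
    rw [mulVec_add, mulVec_smul, mulVec_smul]
  have hy : g *ᵥ y = y 0 • (g *ᵥ std 0) + y 1 • (g *ᵥ std 1) := by
    conv_lhs => rw [eq_sum_std y]
    rw [mulVec_add, mulVec_smul, mulVec_smul]
  rw [hx, hy]
  conv_rhs => rw [eq_sum_std x, eq_sum_std y]
  simp only [herm_add_left, herm_add_right, herm_smul_left, herm_smul_right, h]

/-- `herm` commutes with a ring homomorphism intertwining the involutions -/
theorem herm_map {E' : Type*} [Field E'] (σ' : E' →+* E') (ψ : E →+* E')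
    (hψ : ∀ x, ψ (σ x) = σ' (ψ x)) (d : Fin 2 → E) (x y : Fin 2 → E) :
    ψ (herm σ d x y) = herm σ' (fun i => ψ (d i)) (fun i => ψ (x i)) (fun i => ψ (y i)) := by
  unfold herm
  simp only [map_sum, map_mul, hψ]

/-- the standard basis is carried to the standard basis -/
theorem std_map {E' : Type*} [Field E'] (ψ : E →+* E') (i : Fin 2) :
    (fun k => ψ ((std i : Fin 2 → E) k)) = (std i : Fin 2 → E') := by
  funext k
  unfold std
  by_cases hk : k = i
  · subst hk; simp
  · simp [hk]

/-- `γ.map ψ` applied to a basis vector is the image of `γ` applied to it -/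
theorem map_mulVec_std {E' : Type*} [Field E'] (ψ : E →+* E') (γ : Matrix (Fin 2) (Fin 2) E) (i : Fin 2) :
    (γ.map ψ) *ᵥ (std i : Fin 2 → E') = fun k => ψ ((γ *ᵥ std i) k) := by
  funext k
  rw [RingHom.map_mulVec]
  congr 1
  funext l
  simp only [Function.comp]
  have := congrFun (std_map ψ i) l
  exact this.symm

/-- **base change of the isometry condition**: an isometry of `herm σ d` is carried by `ψ` (intertwining the
involutions) to an isometry of `herm σ′ (ψ ∘ d)` — a polynomial identity in the entries. -/
theorem isIsom_map {E' : Type*} [Field E'] (σ' : E' →+* E') (ψ : E →+* E')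
    (hψ : ∀ x, ψ (σ x) = σ' (ψ x)) (d : Fin 2 → E) {γ : Matrix (Fin 2) (Fin 2) E} (hγ : IsIsom σ d γ) :
    IsIsom σ' (fun i => ψ (d i)) (γ.map ψ) := by
  apply isIsom_of_std
  intro i j
  rw [map_mulVec_std, map_mulVec_std, ← herm_map σ σ' ψ hψ, hγ (std i) (std j), herm_map σ σ' ψ hψ,
    std_map, std_map]

/-- **`κ(γ) ∈ F`**: the invariant is `σ`-fixed (`σ` involutive, the discriminants `σ`-fixed) -/
theorem sigma_kappa (hσ : ∀ x, σ (σ x) = x) (d : Fin 2 → E) (hd : ∀ i, σ (d i) = d i)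
    (f : Fin 2 → Fin 2 → E) (γ : Matrix (Fin 2) (Fin 2) E) :
    σ (kappa σ d f γ) = kappa σ d f γ := by
  have hnrm : ∀ x, σ (nrm σ x) = nrm σ x := by
    intro x
    unfold nrm
    rw [map_mul, hσ, mul_comm]
  have hself : ∀ x : Fin 2 → E, σ (herm σ d x x) = herm σ d x x := by
    intro x
    unfold herm
    rw [map_sum]
    refine Finset.sum_congr rfl fun i _ => ?_
    rw [map_mul, map_mul, hd, hσ, mul_comm (x i)]
  unfold kappa disc'
  rw [map_div₀, map_mul, hnrm, hd, hself]

end general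

/-! ## Over `ℂ`: the global invariant at an archimedean place -/

section complex

open Complex

variable {E : Type*} [Field E] (σ : E →+* E) (ψ : E →+* ℂ) (d : Fin 2 → E) (f : Fin 2 → Fin 2 → E)

/-- **the definite place**: `ψ (κ(γ)) = t ∈ [0, 1]` when the image data form a `Sig20Data` and `γ` is an isometry -/
theorem map_kappa_sig20 (hψ : ∀ x, ψ (σ x) = (starRingEnd ℂ) (ψ x)) {r s : Fin 2 → ℝ} (hdr : ∀ i, ψ (d i) = (r i : ℂ))
    (D : Sig20Data r s (fun j i => ψ (f j i))) {γ : Matrix (Fin 2) (Fin 2) E} (hγ : IsIsom σ d γ) :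
    ∃ t : ℝ, t ∈ Set.Icc (0 : ℝ) 1 ∧ ψ (kappa σ d f γ) = (t : ℂ) := by
  have hiso := isIsom_map σ (starRingEnd ℂ) ψ hψ d hγ
  have hd : (fun i => ψ (d i)) = fun i => (r i : ℂ) := funext hdr
  rw [hd] at hiso
  refine ⟨Complex.normSq ((P r * γ.map ψ * Q r * colMatrix (nf r s (fun j i => ψ (f j i)))) 0 0),
    ⟨Complex.normSq_nonneg _, ?_⟩, map_kappa_eq_normSq_sig20 σ ψ hψ d f hdr D γ⟩
  exact normSq_le_one_of_mem_unitaryGroup (mul_mem (D.mem_unitaryGroup_conj hiso) D.mem_unitaryGroup_colMatrix_nf)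

/-- `‖ψ (κ(γ))‖ ≤ 1` at the definite place — the `Binf = 1` bound for the real `γ` -/
theorem norm_map_kappa_le_one_sig20 (hψ : ∀ x, ψ (σ x) = (starRingEnd ℂ) (ψ x)) {r s : Fin 2 → ℝ} (hdr : ∀ i, ψ (d i) = (r i : ℂ))
    (D : Sig20Data r s (fun j i => ψ (f j i))) {γ : Matrix (Fin 2) (Fin 2) E} (hγ : IsIsom σ d γ) :
    ‖ψ (kappa σ d f γ)‖ ≤ 1 := by
  obtain ⟨t, ⟨ht0, ht1⟩, ht⟩ := map_kappa_sig20 σ ψ d f hψ hdr D hγ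
  rw [ht, Complex.norm_real, Real.norm_eq_abs, abs_of_nonneg ht0]
  exact ht1

/-- **a `(1,1)`-place**: `ψ (κ(γ)) = t` with `1 ≤ t` when the image data form a `Sig11Data` -/
theorem map_kappa_sig11 (hψ : ∀ x, ψ (σ x) = (starRingEnd ℂ) (ψ x)) {r s : Fin 2 → ℝ} (hdr : ∀ i, ψ (d i) = (r i : ℂ))
    (D : Sig11Data r s (fun j i => ψ (f j i))) {γ : Matrix (Fin 2) (Fin 2) E} (hγ : IsIsom σ d γ) :
    ∃ t : ℝ, 1 ≤ t ∧ ψ (kappa σ d f γ) = (t : ℂ) := by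
  have hiso := isIsom_map σ (starRingEnd ℂ) ψ hψ d hγ
  have hd : (fun i => ψ (d i)) = fun i => (r i : ℂ) := funext hdr
  rw [hd] at hiso
  refine ⟨Complex.normSq ((P r * γ.map ψ * Q r * colMatrix (nf r s (fun j i => ψ (f j i)))) 0 0), ?_,
    map_kappa_eq_normSq_sig11 σ ψ hψ d f hdr D γ⟩
  exact one_le_normSq_of_memU11 (memU11_mul (D.memU11_conj hiso) D.memU11_colMatrix_nf)

/-- **a `(1,1)`-place with the negative line first**: `ψ (κ(γ))` is real and `≤ 0` -/
theorem map_kappa_sig11_swap (hψ : ∀ x, ψ (σ x) = (starRingEnd ℂ) (ψ x)) {r s : Fin 2 → ℝ} (hdr : ∀ i, ψ (d i) = (r i : ℂ)) (hr0 : r 0 < 0) (hr1 : 0 < r 1)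
    (hs0 : 0 < s 0) (hs1 : s 1 < 0)
    (hf0 : disc' (starRingEnd ℂ) (fun i => (r i : ℂ)) (fun j i => ψ (f j i)) 0 = (s 0 : ℂ))
    (hf1 : disc' (starRingEnd ℂ) (fun i => (r i : ℂ)) (fun j i => ψ (f j i)) 1 = (s 1 : ℂ))
    (horth : herm (starRingEnd ℂ) (fun i => (r i : ℂ)) (fun i => ψ (f 0 i)) (fun i => ψ (f 1 i)) = 0)
    {γ : Matrix (Fin 2) (Fin 2) E} (hγ : IsIsom σ d γ) :
    (ψ (kappa σ d f γ)).im = 0 ∧ (ψ (kappa σ d f γ)).re ≤ 0 := by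
  have hiso := isIsom_map σ (starRingEnd ℂ) ψ hψ d hγ
  have hd : (fun i => ψ (d i)) = fun i => (r i : ℂ) := funext hdr
  rw [hd] at hiso
  rw [kappa_map σ (starRingEnd ℂ) ψ hψ d f γ, hd]
  refine ⟨?_, kappa_nonpos_of_neg_first hr0 hr1 hs0 hs1 (fun j i => ψ (f j i)) hf0 hf1 horth hiso⟩
  rw [kappa_eq_one_sub_normSq_of_neg_first hr0 hr1 hs0 (fun j i => ψ (f j i)) hf0 hiso]
  simp

/-! ### The `InfinitePlace` form for `κ` read in a number field `K ⊆ F` -/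

variable {K : Type*} [Field K] [Algebra K E] (φ : K →+* ℂ)

/-- `|κ|_w ≤ 1` at the infinite place `w = InfinitePlace.mk φ` of a definite place -/
theorem infinitePlace_kappa_le_one (hψ : ∀ x, ψ (σ x) = (starRingEnd ℂ) (ψ x)) (hφ : ∀ x, ψ (algebraMap K E x) = φ x)
    {r s : Fin 2 → ℝ} (hdr : ∀ i, ψ (d i) = (r i : ℂ))
    (D : Sig20Data r s (fun j i => ψ (f j i))) {γ : Matrix (Fin 2) (Fin 2) E} (hγ : IsIsom σ d γ)
    (κF : K) (hκ : algebraMap K E κF = kappa σ d f γ) :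
    NumberField.InfinitePlace.mk φ κF ≤ 1 := by
  rw [NumberField.InfinitePlace.apply, ← hφ, hκ]
  exact norm_map_kappa_le_one_sig20 σ ψ d f hψ hdr D hγ

/-- `1 ≤ |κ|_w` at the infinite place `w = InfinitePlace.mk φ` of a `(1,1)`-place (positive line first) -/
theorem one_le_infinitePlace_kappa (hψ : ∀ x, ψ (σ x) = (starRingEnd ℂ) (ψ x)) (hφ : ∀ x, ψ (algebraMap K E x) = φ x)
    {r s : Fin 2 → ℝ} (hdr : ∀ i, ψ (d i) = (r i : ℂ))
    (D : Sig11Data r s (fun j i => ψ (f j i))) {γ : Matrix (Fin 2) (Fin 2) E} (hγ : IsIsom σ d γ)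
    (κF : K) (hκ : algebraMap K E κF = kappa σ d f γ) :
    1 ≤ NumberField.InfinitePlace.mk φ κF := by
  rw [NumberField.InfinitePlace.apply, ← hφ, hκ]
  obtain ⟨t, ht1, ht⟩ := map_kappa_sig11 σ ψ d f hψ hdr D hγ
  rw [ht, Complex.norm_real, Real.norm_eq_abs, abs_of_nonneg (by linarith)]
  exact ht1

/-- **the `hT` bound of `ProductFormulaSeparation.inv_mul_pow_le_archSizeOn` at a definite place**:
`|κ(γ) − κ(γ₀)|_w ≤ 1` (`Binf w = 1`) for any two isometries `γ, γ₀`, at `w = InfinitePlace.mk φ` -/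
theorem infinitePlace_kappa_sub_le_one (hψ : ∀ x, ψ (σ x) = (starRingEnd ℂ) (ψ x))
    (hφ : ∀ x, ψ (algebraMap K E x) = φ x) {r s : Fin 2 → ℝ} (hdr : ∀ i, ψ (d i) = (r i : ℂ))
    (D : Sig20Data r s (fun j i => ψ (f j i))) {γ γ₀ : Matrix (Fin 2) (Fin 2) E} (hγ : IsIsom σ d γ)
    (hγ₀ : IsIsom σ d γ₀) (κF κF₀ : K) (hκ : algebraMap K E κF = kappa σ d f γ)
    (hκ₀ : algebraMap K E κF₀ = kappa σ d f γ₀) :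
    NumberField.InfinitePlace.mk φ (κF - κF₀) ≤ 1 := by
  rw [NumberField.InfinitePlace.apply, map_sub, ← hφ, ← hφ, hκ, hκ₀]
  obtain ⟨t, ⟨ht0, ht1⟩, ht⟩ := map_kappa_sig20 σ ψ d f hψ hdr D hγ
  obtain ⟨t₀, ⟨ht00, ht01⟩, ht₀⟩ := map_kappa_sig20 σ ψ d f hψ hdr D hγ₀
  rw [ht, ht₀, ← Complex.ofReal_sub, Complex.norm_real, Real.norm_eq_abs, abs_le]
  constructor <;> linarith

end complex

/-! ## Phase reduction: `κ` is invariant under `γ ↦ c • γ` with `N(c) = 1` (t7-crit-2 l. 15229 record (i)) -/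

section phase

variable {E : Type*} [Field E] (σ : E →+* E)

/-- `κ(c • γ) = N(c) · κ(γ)` -/
theorem kappa_smul_mat (d : Fin 2 → E) (f : Fin 2 → Fin 2 → E) (c : E) (γ : Matrix (Fin 2) (Fin 2) E) :
    kappa σ d f (c • γ) = nrm σ c * kappa σ d f γ := by
  unfold kappa cc
  rw [smul_mulVec, Pi.smul_apply, smul_eq_mul, mul_left_comm, nrm_mul, mul_div_assoc]

/-- `c • γ` is an isometry when `γ` is and `N(c) = 1` -/
theorem isIsom_smul (d : Fin 2 → E) {c : E} (hc : nrm σ c = 1) {γ : Matrix (Fin 2) (Fin 2) E}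
    (hγ : IsIsom σ d γ) : IsIsom σ d (c • γ) := by
  intro x y
  rw [smul_mulVec, smul_mulVec, herm_smul_left, herm_smul_right, hγ, ← mul_assoc]
  have : c * σ c = 1 := hc
  rw [this, one_mul]

open Complex in
/-- **the literal `SU(1,1)` form for EVERY isometry** (no `det γ = 1` needed): a phase `c` with `|c| = 1` makes
`det (c • γ) = 1`, κ is unchanged, and `KappaArchimedean.Sig11Data.exists_SU11` applies to `c • γ`. -/
theorem Sig11Data.exists_SU11' {r s : Fin 2 → ℝ} {f : Fin 2 → Fin 2 → ℂ} (D : Sig11Data r s f)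
    {γ : Matrix (Fin 2) (Fin 2) ℂ} (hγ : IsIsom (starRingEnd ℂ) (fun i => (r i : ℂ)) γ) :
    ∃ c : ℂ, Complex.normSq c = 1 ∧ ∃ γ' h : T5SU11Unimodular.SU11,
      T5BergmanCoefficient.mat γ' = P r * (c • γ) * Q r ∧
      kappa (starRingEnd ℂ) (fun i => (r i : ℂ)) f γ =
        (Complex.normSq (T5BergmanCoefficient.mat (γ' * h) 0 0) : ℂ) := by
  have hu : (Complex.normSq γ.det : ℂ) = 1 := by
    have := normSq_det_of_memU11 (D.memU11_conj hγ)
    rw [det_conj D.hr] at this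
    exact this
  have hu' : Complex.normSq γ.det = 1 := by exact_mod_cast hu
  have hu0 : γ.det ≠ 0 := by
    intro h; rw [h, map_zero] at hu'; exact zero_ne_one hu'
  obtain ⟨c, hc⟩ := IsAlgClosed.exists_pow_nat_eq (γ.det)⁻¹ (by norm_num : 0 < 2)
  have hc1 : Complex.normSq c = 1 := by
    have h1 : Complex.normSq c ^ 2 = 1 := by
      rw [← map_pow, hc, Complex.normSq_inv, hu', inv_one]
    have h0 : 0 ≤ Complex.normSq c := Complex.normSq_nonneg c
    nlinarith [sq_nonneg (Complex.normSq c - 1), sq_nonneg (Complex.normSq c + 1)]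
  have hnrm : nrm (starRingEnd ℂ) c = 1 := by
    rw [Tier7.Line3.KappaDefiniteBound.nrm_conjC, hc1]; simp
  have hdet : (c • γ).det = 1 := by
    rw [det_smul, Fintype.card_fin, hc, inv_mul_cancel₀ hu0]
  obtain ⟨γ', h, hmat, -, hk⟩ := D.exists_SU11 (isIsom_smul (starRingEnd ℂ) _ hnrm hγ) hdet
  refine ⟨c, hc1, γ', h, hmat, ?_⟩
  rw [← hk, kappa_smul_mat, hnrm, one_mul]

end phase

end Summit.Ventures.HodgeRepro2.Tier7.Line3.KappaPlaces
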